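import Literature.AlgebraicGeometry.Resolution.FormalBranchesModel
import Literature.AlgebraicGeometry.Resolution.DerivativeIdeals
import Mathlib.LinearAlgebra.Matrix.NonsingularInverse
import HarnessLib

/-!
# The ideal of the double locus from the partial derivatives of the equation

Topic: `Literature/AlgebraicGeometry/Resolution`. Fourth file of the Artin-approximation-free
proof that FORMAL normal crossings are étale-local normal crossings (de Jong 1996, between
4.25 (i) and 4.28/2.4; the named fact `DeJong1996FormalNormalCrossings` of
`AlterationsNormalFormBlowup.lean`), after `FormalBranchesModel.lean` (the chart of the formal
model), `FormalBranchesChart.lean` (the chart over the algebraic local ring and its base change)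
and `FormalBranchesSplitting.lean` (étale splitting and descent). Everything here is PROVED; no
named facts.

The chart of the double locus must be formed over the ALGEBRAIC local ring `A` from an ideal
`𝔇 ⊆ A` and an element `s ∈ A` whose images in the formal model `P` (`A → P`, in the
application `P = Â ≅ k⟦X⟧`) are the ideal `(m_j)_{j<r}` of the double locus of
`π = x₁ ⋯ x_r` and a generic combination `Σ_j a_j m_j` (`a_j` units) — modulo `(π)`. No such
`𝔇` can be read off the equation alone; it is the JACOBIAN ideal. Let `D₁, …, D_d` be
derivations of `A` and `Dh₁, …, Dh_d` derivations of `P` extending them, `u₁, …, u_d ∈ A` with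
`Dᵢ(u_j) = δᵢⱼ` and `u_j ≡ x_j (mod 𝔪_P²)`, and `g ∈ A` with `g = v·π` in `P` (`v` a unit). Put
`𝔇 = (g, D₁ g, …, D_d g)` (`doubleLocusIdealAlg`) and `s = Σ_{i<r} Dᵢ g` (`genericElement`).

* `apply_branchProd` — `Dhᵢ(π) = Σ_{l<r} m_l · Dhᵢ(x_l)` (Leibniz);
* `isUnit_det_jacobianMatrix`, `branchCofactor_mem_span_apply_branchProd` — the Jacobian matrix
  `(Dhᵢ(x_l))_{i,l<r}` is `≡ 1 (mod 𝔪_P)` (`apply_x_sub_ite_mem`: derivations map `𝔪²` into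
  `𝔪`), hence invertible, so each cofactor `m_j` is a `P`-combination of the `Dhᵢ(π)`;
* `map_doubleLocusIdealAlg_sup_span`, `map_map_doubleLocusIdealAlg` — **`𝔇·P ≡ (m_j)_{j<r}`
  modulo `(π)`** (`Dhᵢ(g) = Dhᵢ(v)π + v·Dhᵢ(π)`);
* `isUnit_genericCoeff`, `mk_algebraMap_genericElement` — **`s ≡ Σ_l a_l m_l (mod π)`** with the
  UNITS `a_l = v·Σ_{i<r} Dhᵢ(x_l) ≡ v`.

These are exactly the hypotheses `h𝔇`, `hs` of `doubleLocusChartEquiv`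
(`FormalBranchesChart.lean`).

## Sources

* A. J. de Jong, *Smoothness, semi-stability and alterations*, Publ. Math. IHÉS 83 (1996),
  4.25 (i), p. 75. [DeJong1996]
* H. Matsumura, *Commutative Ring Theory* (1986), §30 (Jacobian ideals and derivations of
  local rings; Thm. 30.6 (ii) for the dual derivations `Dᵢ(u_j) = δᵢⱼ`). [Matsumura1987]
-/

noncomputable section

open IsLocalRing

namespace Literature.AlgebraicGeometry.Resolution

universe u v

/-! ## Leibniz for finite products -/

/-- **Leibniz rule for a finite product**: `D (∏_{i ∈ s} f i) = ∑_{i ∈ s} (∏_{j ∈ s, j ≠ i} f j) · D (f i)`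
(a local copy of the lemma of the same content in `HarishChandraGLProofs.lean`, not imported
here). [folklore] -/
theorem Derivation.apply_finset_prod {K : Type*} [CommRing K] {R : Type*} [CommRing R]
    [Algebra K R] {ι : Type*} [DecidableEq ι] (D : Derivation K R R) (s : Finset ι) (f : ι → R) :
    D (∏ i ∈ s, f i) = ∑ i ∈ s, (∏ j ∈ s.erase i, f j) * D (f i) := by
  induction s using Finset.induction_on with
  | empty => simp
  | insert a s ha ih =>
    rw [Finset.prod_insert ha, Derivation.leibniz, ih, Finset.sum_insert ha,
      Finset.erase_insert ha, smul_eq_mul, smul_eq_mul, add_comm, Finset.mul_sum]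
    congr 1
    refine Finset.sum_congr rfl fun i hi => ?_
    rw [Finset.erase_insert_of_ne (by rintro rfl; exact ha hi),
      Finset.prod_insert (fun h => ha (Finset.mem_of_mem_erase h)), mul_assoc]

section Jacobian

variable {d : ℕ} {P : Type u} [CommRing P] [IsLocalRing P] (x : Fin d → P) (r : ℕ)
variable (Dh : Fin d → Derivation ℤ P P)

/-- The Jacobian matrix `N_{il} = Dᵢ(x_l)` of the formal coordinates against the derivations,
restricted to the branch indices `i, l < r`. [folklore] -/
def jacobianMatrix : Matrix ↥(branchSet d r) ↥(branchSet d r) P :=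
  Matrix.of fun i l => Dh i.1 (x l.1)

variable {x r Dh}

omit [IsLocalRing P] in
/-- **`Dᵢ(π) = Σ_l m_l · Dᵢ(x_l)`**: the derivative of the normal crossings equation
`π = ∏_{l<r} x_l` is the Jacobian combination of the cofactors `m_l`. [folklore] -/
theorem apply_branchProd (i : Fin d) :
    Dh i (branchProd x r) = ∑ l ∈ branchSet d r, branchCofactor x r l * Dh i (x l) := by
  classical
  unfold branchProd branchCofactor
  exact Derivation.apply_finset_prod (Dh i) (branchSet d r) x

omit [IsLocalRing P] in
/-- The same as a matrix identity: `(Dᵢ π)_{i<r} = N · (m_l)_{l<r}`. [folklore] -/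
theorem apply_branchProd_eq_mulVec (i : ↥(branchSet d r)) :
    Dh i.1 (branchProd x r) =
      (jacobianMatrix x r Dh).mulVec (fun l : ↥(branchSet d r) => branchCofactor x r l.1) i := by
  rw [apply_branchProd, Matrix.mulVec, dotProduct, ← Finset.sum_coe_sort (branchSet d r)]
  refine Finset.sum_congr rfl fun l _ => ?_
  rw [jacobianMatrix, Matrix.of_apply, mul_comm]

variable (hN : ∀ i l : ↥(branchSet d r), Dh i.1 (x l.1) - (if i = l then 1 else 0) ∈ maximalIdeal P)

include hN in
/-- If `Dᵢ(x_l) ≡ δ_{il}` modulo `𝔪`, the Jacobian matrix is `≡ 1`, hence its determinant is a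
unit. [folklore] -/
theorem isUnit_det_jacobianMatrix : IsUnit (jacobianMatrix x r Dh).det := by
  classical
  have hmap : (jacobianMatrix x r Dh).map (Ideal.Quotient.mk (maximalIdeal P)) = 1 := by
    ext i l
    rw [Matrix.map_apply, jacobianMatrix, Matrix.of_apply, Matrix.one_apply]
    have h := hN i l
    rw [← Ideal.Quotient.eq_zero_iff_mem, map_sub] at h
    rw [sub_eq_zero] at h
    rw [h]
    split_ifs <;> simp
  have hdet : Ideal.Quotient.mk (maximalIdeal P) (jacobianMatrix x r Dh).det = 1 := by
    rw [RingHom.map_det, RingHom.mapMatrix_apply, hmap, Matrix.det_one]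
  by_contra hu
  have hmem : (jacobianMatrix x r Dh).det ∈ maximalIdeal P := (mem_maximalIdeal _).mpr hu
  rw [← Ideal.Quotient.eq_zero_iff_mem, hdet] at hmem
  exact one_ne_zero hmem

include hN in
/-- **The cofactors are combinations of the derivatives of the equation**: each `m_j`, `j < r`,
lies in the ideal generated by the `Dᵢ(π)`, `i < r` (invert the Jacobian matrix). [folklore] -/
theorem branchCofactor_mem_span_apply_branchProd {j : Fin d} (hj : j ∈ branchSet d r) :
    branchCofactor x r j ∈
      Ideal.span (Set.range fun i : ↥(branchSet d r) => Dh i.1 (branchProd x r)) := by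
  classical
  set N := jacobianMatrix x r Dh
  set m : ↥(branchSet d r) → P := fun l => branchCofactor x r l.1
  set v : ↥(branchSet d r) → P := fun i => Dh i.1 (branchProd x r)
  have hv : v = N.mulVec m := funext fun i => apply_branchProd_eq_mulVec i
  have hdet := isUnit_det_jacobianMatrix hN
  have hm : m = N⁻¹.mulVec v := by
    rw [hv, Matrix.mulVec_mulVec, Matrix.nonsing_inv_mul _ hdet, Matrix.one_mulVec]
  have hmj : branchCofactor x r j = (N⁻¹.mulVec v) ⟨j, hj⟩ := congrFun hm ⟨j, hj⟩
  rw [hmj, Matrix.mulVec, dotProduct]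
  exact Ideal.sum_mem _ fun i _ => Ideal.mul_mem_left _ _ (Ideal.subset_span ⟨i, rfl⟩)

end Jacobian

/-! ## The double locus ideal and the generic element from derivatives on the algebraic side -/

section Algebraic

variable {A : Type v} [CommRing A] {d : ℕ} {P : Type u} [CommRing P] [IsLocalRing P] [Algebra A P]
variable (x : Fin d → P) (r : ℕ)
variable (D : Fin d → Derivation ℤ A A) (Dh : Fin d → Derivation ℤ P P)
variable (u : Fin d → A) (g : A) (v : Pˣ)

/-- **The ideal of the double locus, algebraic side**: `𝔇 = (g, D₁ g, …, D_d g) ⊆ A`, the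
equation of the divisor together with its partial derivatives. [folklore] -/
def doubleLocusIdealAlg : Ideal A := Ideal.span (insert g (Set.range fun i => D i g))

/-- **The generic element**: `s = Σ_{i<r} Dᵢ g ∈ 𝔇`. [folklore] -/
def genericElement : A := ∑ i ∈ branchSet d r, D i g

/-- The coefficients `a_l = v · Σ_{i<r} Dᵢ(x_l)` of the generic element on the cofactors.
[folklore] -/
def genericCoeff (l : Fin d) : P := (v : P) * ∑ i ∈ branchSet d r, Dh i (x l)

/-- `g ∈ 𝔇`. [folklore] -/
theorem mem_doubleLocusIdealAlg_self : g ∈ doubleLocusIdealAlg D g :=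
  Ideal.subset_span (Set.mem_insert _ _)

/-- `Dᵢ g ∈ 𝔇`. [folklore] -/
theorem apply_mem_doubleLocusIdealAlg (i : Fin d) : D i g ∈ doubleLocusIdealAlg D g :=
  Ideal.subset_span (Set.mem_insert_of_mem _ ⟨i, rfl⟩)

/-- `s ∈ 𝔇`. [folklore] -/
theorem genericElement_mem : genericElement r D g ∈ doubleLocusIdealAlg D g :=
  Ideal.sum_mem _ fun i _ => apply_mem_doubleLocusIdealAlg D g i

variable {x r D Dh u g v}
variable (hcompat : ∀ i a, algebraMap A P (D i a) = Dh i (algebraMap A P a))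
  (hDu : ∀ i j, D i (u j) = if i = j then 1 else 0)
  (hu : ∀ j, algebraMap A P (u j) - x j ∈ maximalIdeal P ^ 2)
  (hg : algebraMap A P g = v * branchProd x r)

include hcompat hDu hu in
/-- **The Jacobian matrix is `≡ 1` modulo `𝔪_P`**: `Dᵢ(x_l) ≡ Dᵢ(u_l) = δ_{il}`, because
`u_l ≡ x_l (mod 𝔪²)` and derivations map `𝔪²` into `𝔪`. [folklore] -/
theorem apply_x_sub_ite_mem (i l : Fin d) :
    Dh i (x l) - (if i = l then 1 else 0) ∈ maximalIdeal P := by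
  have h1 : Dh i (algebraMap A P (u l) - x l) ∈ maximalIdeal P := by
    have := Derivation.apply_mem_pow_sub_one ℤ (Dh i) (maximalIdeal P) 2 (hu l)
    simpa using this
  have h2 : Dh i (algebraMap A P (u l)) = if i = l then 1 else 0 := by
    rw [← hcompat, hDu]
    split_ifs <;> simp
  have h3 : Dh i (x l) - (if i = l then 1 else 0) = -(Dh i (algebraMap A P (u l) - x l)) := by
    rw [map_sub, h2]; ring
  rw [h3]
  exact Submodule.neg_mem _ h1

include hcompat hDu hu in
/-- The same on the branch indices. [folklore] -/
theorem apply_x_sub_ite_mem' (i l : ↥(branchSet d r)) :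
    Dh i.1 (x l.1) - (if i = l then 1 else 0) ∈ maximalIdeal P := by
  by_cases h : i = l
  · subst h
    simpa using apply_x_sub_ite_mem hcompat hDu hu i.1 i.1
  · have h' : i.1 ≠ l.1 := fun e => h (Subtype.ext e)
    simpa [h, h'] using apply_x_sub_ite_mem hcompat hDu hu i.1 l.1

omit [IsLocalRing P] in
include hg in
/-- `Dᵢ(ι g) = Dᵢ(v)·π + v·Dᵢ(π)`. [folklore] -/
theorem apply_algebraMap_g (i : Fin d) :
    Dh i (algebraMap A P g) = Dh i (v : P) * branchProd x r + (v : P) * Dh i (branchProd x r) := by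
  rw [hg, Derivation.leibniz, smul_eq_mul, smul_eq_mul, add_comm, mul_comm (branchProd x r)]

include hcompat hDu hu hg in
/-- **The extension of `𝔇` is the ideal of the double locus, modulo the equation**:
`𝔇·P + (π) = (m_j)_{j<r} + (π)`. (`⊆`: `ι g = vπ`, `Dᵢ(ι g) = Dᵢ(v)π + v Σ_l m_l Dᵢ(x_l)`;
`⊇`: `m_j = Σ_i c_{ji} Dᵢ(π)` by the inverted Jacobian, `Dᵢ(π) = v⁻¹(Dᵢ(ι g) - Dᵢ(v)π)`.)
[folklore] -/
theorem map_doubleLocusIdealAlg_sup_span :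
    (doubleLocusIdealAlg D g).map (algebraMap A P) ⊔ Ideal.span {branchProd x r} =
      doubleLocusIdeal x r ⊔ Ideal.span {branchProd x r} := by
  classical
  have hN := apply_x_sub_ite_mem' (r := r) hcompat hDu hu
  have hDπ : ∀ i, Dh i (branchProd x r) ∈ doubleLocusIdeal x r := fun i => by
    rw [apply_branchProd]
    exact Ideal.sum_mem _ fun l hl => Ideal.mul_mem_right _ _ (branchCofactor_mem_doubleLocusIdeal hl)
  apply le_antisymm
  · -- `⊆`
    refine sup_le ?_ le_sup_right
    rw [doubleLocusIdealAlg, Ideal.map_span, Ideal.span_le]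
    rintro _ ⟨a, ha, rfl⟩
    rcases ha with rfl | ⟨i, rfl⟩
    · rw [SetLike.mem_coe, hg]
      exact Ideal.mem_sup_right (Ideal.mul_mem_left _ _ (Ideal.mem_span_singleton_self _))
    · rw [SetLike.mem_coe, hcompat, apply_algebraMap_g hg]
      exact Ideal.add_mem _
        (Ideal.mem_sup_right (Ideal.mul_mem_left _ _ (Ideal.mem_span_singleton_self _)))
        (Ideal.mem_sup_left (Ideal.mul_mem_left _ _ (hDπ i)))
  · -- `⊇`
    refine sup_le ?_ le_sup_right
    rw [doubleLocusIdeal, Ideal.span_le]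
    rintro _ ⟨j, hj, rfl⟩
    have hDπ' : ∀ i, Dh i (branchProd x r) ∈
        (doubleLocusIdealAlg D g).map (algebraMap A P) ⊔ Ideal.span {branchProd x r} := by
      intro i
      have h1 : Dh i (branchProd x r) =
          ((v⁻¹ : Pˣ) : P) * (Dh i (algebraMap A P g) - Dh i (v : P) * branchProd x r) := by
        rw [apply_algebraMap_g hg, add_sub_cancel_left, ← mul_assoc, Units.inv_mul, one_mul]
      rw [h1]
      refine Ideal.mul_mem_left _ _ (Ideal.sub_mem _ ?_ ?_)
      · rw [← hcompat]
        exact Ideal.mem_sup_left (Ideal.mem_map_of_mem _ (apply_mem_doubleLocusIdealAlg D g i))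
      · exact Ideal.mem_sup_right (Ideal.mul_mem_left _ _ (Ideal.mem_span_singleton_self _))
    have hmem := branchCofactor_mem_span_apply_branchProd hN (Finset.mem_coe.mp hj)
    refine (Ideal.span_le.mpr ?_) hmem
    rintro _ ⟨i, rfl⟩
    exact hDπ' i.1

include hcompat hDu hu hg in
/-- The same modulo the equation: the images of `𝔇·P` and of the ideal of the double locus in
`P/(π)` agree (the hypothesis `h𝔇` of `doubleLocusChartEquiv`, `FormalBranchesChart.lean`).
[folklore] -/
theorem map_map_doubleLocusIdealAlg :
    ((doubleLocusIdealAlg D g).map (algebraMap A P)).map (Ideal.Quotient.mk (Ideal.span {branchProd x r})) =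
      (doubleLocusIdeal x r).map (Ideal.Quotient.mk _) := by
  have key := congrArg (Ideal.map (Ideal.Quotient.mk (Ideal.span {branchProd x r})))
    (map_doubleLocusIdealAlg_sup_span hcompat hDu hu hg)
  have h0 : (Ideal.span {branchProd x r}).map (Ideal.Quotient.mk (Ideal.span {branchProd x r})) = ⊥ := by
    rw [Ideal.map_quotient_self]
  rwa [Ideal.map_sup, Ideal.map_sup, h0, sup_bot_eq, sup_bot_eq] at key

include hcompat hDu hu in
/-- The coefficients `a_l`, `l < r`, are units: `Σ_{i<r} Dᵢ(x_l) ≡ Σ_{i<r} δ_{il} = 1`.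
[folklore] -/
theorem isUnit_genericCoeff {l : Fin d} (hl : l ∈ branchSet d r) : IsUnit (genericCoeff x r Dh v l) := by
  classical
  refine (Units.isUnit v).mul ?_
  have hmem : ∑ i ∈ branchSet d r, Dh i (x l) - 1 ∈ maximalIdeal P := by
    have h1 : ∑ i ∈ branchSet d r, (Dh i (x l) - if i = l then 1 else 0) ∈ maximalIdeal P :=
      Ideal.sum_mem _ fun i _ => apply_x_sub_ite_mem hcompat hDu hu i l
    rwa [Finset.sum_sub_distrib, Finset.sum_ite_eq' (branchSet d r) l, if_pos hl] at h1
  by_contra hnu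
  have : (1 : P) ∈ maximalIdeal P := by
    have h2 := Ideal.sub_mem _ ((mem_maximalIdeal _).mpr hnu) hmem
    rwa [sub_sub_cancel] at h2
  exact (maximalIdeal.isMaximal P).ne_top ((Ideal.eq_top_iff_one _).mpr this)

omit [IsLocalRing P] in
include hcompat hg in
/-- **The generic element is generic**: modulo the equation, `ι(s) ≡ Σ_l a_l m_l` with the unit
coefficients `a_l` (the hypothesis `hs` of `doubleLocusChartEquiv`). [folklore] -/
theorem mk_algebraMap_genericElement :
    Ideal.Quotient.mk (Ideal.span {branchProd x r}) (algebraMap A P (genericElement r D g)) =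
      Ideal.Quotient.mk _ (cofactorSum x r (genericCoeff x r Dh v)) := by
  classical
  rw [Ideal.Quotient.eq, Ideal.mem_span_singleton']
  refine ⟨∑ i ∈ branchSet d r, Dh i (v : P), ?_⟩
  rw [genericElement, map_sum, cofactorSum]
  simp_rw [hcompat, apply_algebraMap_g hg, apply_branchProd, genericCoeff]
  rw [Finset.sum_add_distrib, Finset.sum_mul]
  simp_rw [Finset.mul_sum, Finset.sum_mul]
  rw [Finset.sum_comm]
  have : ∀ l ∈ branchSet d r, ∑ i ∈ branchSet d r, (v : P) * (branchCofactor x r l * Dh i (x l)) =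
      ∑ i ∈ branchSet d r, (v : P) * Dh i (x l) * branchCofactor x r l := fun l _ =>
    Finset.sum_congr rfl fun i _ => by ring
  rw [Finset.sum_congr rfl this]
  ring

end Algebraic

end Literature.AlgebraicGeometry.Resolution

end
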